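import Mathlib
import Summits.Ventures.DiscreteObjects.Mahler.SmallMeasureCensus

/-!
# Newton's identities for the roots of a monic integer polynomial, as a list recursion (target L)

Cell `pub-namedobj`, seat `pub-namedobj-mahler-g12`. Framing: lottery ticket; floor = certified bounds/negative
ranges.

For a monic `p ∈ ℤ[X]` of degree `n` with complex roots `z₁, …, zₙ` (with multiplicity) the power sums
`P_k = Σ zᵢ^k` are integers given by Newton's recursion `P_k = -k c_k - Σ_{0<i<k} c_i P_{k-i}`, where
`p = xⁿ + c₁ xⁿ⁻¹ + ⋯ + cₙ` and `c_i = 0` for `i > n`. We implement the recursion on coefficient LISTS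
(`newtonNext`, `psumsRev cs K = [P_K, …, P_1]` for `cs = [c₁, …, cₙ]`) — this is what the kernel census search
evaluates — and prove `rootPowerSum_eq_psumsRev`: the list entries ARE the complex power sums of the roots. The
analytic input is Mathlib's `MvPolynomial.psum_eq_mul_esymm_sub_sum` (Newton's identities for symmetric
functions) evaluated at the roots, together with Vieta (`Polynomial.coeff_eq_esymm_roots_of_card`).
-/

namespace Summit.Ventures.DiscreteObjects.Mahler

open Polynomial

/-! ## The list recursion -/

/-- One Newton step: from `cs = [c₁,…,cₙ]` and `prev = [P_{k-1},…,P_1]` compute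
`P_k = -k·c_k - Σ_{i=1}^{k-1} c_i P_{k-i}`. -/
def newtonNext (cs prev : List ℤ) : ℤ :=
  -(((prev.length + 1 : ℕ) : ℤ) * cs.getD prev.length 0) - (List.zipWith (· * ·) cs prev).sum

/-- Prepend the next power sum. -/
def psumsStep (cs prev : List ℤ) : List ℤ := newtonNext cs prev :: prev

/-- `psumsRev cs K = [P_K, P_{K-1}, …, P_1]`. -/
def psumsRev (cs : List ℤ) : ℕ → List ℤ
  | 0 => []
  | K + 1 => psumsStep cs (psumsRev cs K)

/-- `psumsRev cs 0 = []`. -/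
@[simp] theorem psumsRev_zero (cs : List ℤ) : psumsRev cs 0 = [] := rfl

/-- Unfolding one step of `psumsRev`. -/
theorem psumsRev_succ (cs : List ℤ) (K : ℕ) :
    psumsRev cs (K + 1) = newtonNext cs (psumsRev cs K) :: psumsRev cs K := rfl

/-- `psumsRev cs K` has length `K`. -/
@[simp] theorem length_psumsRev (cs : List ℤ) (K : ℕ) : (psumsRev cs K).length = K := by
  induction K with
  | zero => rfl
  | succ K ih => rw [psumsRev_succ, List.length_cons, ih]

/-- Entry `j` of `psumsRev cs K` is the head of `psumsRev cs (K - j)`. -/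
theorem getD_psumsRev (cs : List ℤ) (K j : ℕ) (hj : j < K) :
    (psumsRev cs K).getD j 0 = (psumsRev cs (K - j)).getD 0 0 := by
  induction K generalizing j with
  | zero => omega
  | succ K ih =>
    cases j with
    | zero => rfl
    | succ j => rw [psumsRev_succ, List.getD_cons_succ, ih j (by omega), show K + 1 - (j + 1) = K - j by omega]

/-- The `zipWith`-sum as a `Finset` sum. -/
theorem sum_zipWith_mul_eq (l m : List ℤ) :
    (List.zipWith (· * ·) l m).sum = ∑ j ∈ Finset.range m.length, l.getD j 0 * m.getD j 0 := by
  induction m generalizing l with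
  | nil => simp
  | cons b m ih =>
    cases l with
    | nil => simp
    | cons a l =>
      rw [List.zipWith_cons_cons, List.sum_cons, List.length_cons, Finset.sum_range_succ', ih]
      simp [add_comm]

/-! ## Power sums of the roots -/

/-- `P_k(p) = Σ_{z ∈ roots_ℂ(p)} z^k` (roots with multiplicity). -/
noncomputable def rootPowerSum (p : ℤ[X]) (k : ℕ) : ℂ :=
  (((p.map (Int.castRingHom ℂ)).roots).map fun z => z ^ k).sum

/-- Definitional unfolding of `rootPowerSum`. -/
theorem rootPowerSum_def (p : ℤ[X]) (k : ℕ) :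
    rootPowerSum p k = (((p.map (Int.castRingHom ℂ)).roots).map fun z => z ^ k).sum := rfl

/-- The descending coefficients `c_i` of a polynomial of degree `n`: `c_i = coeff (n - i)` for `i ≤ n`, else `0`. -/
def descCoeff (p : ℤ[X]) (i : ℕ) : ℤ := if i ≤ p.natDegree then p.coeff (p.natDegree - i) else 0

/-- The list `[c₁, …, cₙ]`. -/
def descCoeffList (p : ℤ[X]) : List ℤ := (List.range p.natDegree).map fun j => p.coeff (p.natDegree - 1 - j)

/-- `descCoeffList p` has length `deg p`. -/
@[simp] theorem length_descCoeffList (p : ℤ[X]) : (descCoeffList p).length = p.natDegree := by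
  simp [descCoeffList]

/-- Entry `j` of `descCoeffList p` is `c_{j+1}`. -/
theorem getD_descCoeffList (p : ℤ[X]) (j : ℕ) : (descCoeffList p).getD j 0 = descCoeff p (j + 1) := by
  unfold descCoeffList descCoeff
  by_cases hj : j < p.natDegree
  · rw [List.getD_eq_getElem _ _ (by simpa using hj)]
    simp [show j + 1 ≤ p.natDegree by omega, show p.natDegree - 1 - j = p.natDegree - (j + 1) by omega]
  · rw [List.getD_eq_default _ _ (by simpa using hj)]
    simp [show ¬ (j + 1 ≤ p.natDegree) by omega]

/-- **Newton's identity for the roots** (range form): for monic `p` and `k ≥ 1`,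
`P_k = -k c_k - Σ_{j < k-1} c_{j+1} P_{k-1-j}`. -/
theorem rootPowerSum_newton {p : ℤ[X]} (hp : p.Monic) {k : ℕ} (hk : 1 ≤ k) :
    rootPowerSum p k = -((k : ℂ) * (descCoeff p k : ℂ)) -
      ∑ j ∈ Finset.range (k - 1), (descCoeff p (j + 1) : ℂ) * rootPowerSum p (k - 1 - j) := by
  set n := p.natDegree with hn
  set q : ℂ[X] := p.map (Int.castRingHom ℂ) with hq
  have hqmonic : q.Monic := hp.map _
  have hqdeg : q.natDegree = n := by rw [hq, hp.natDegree_map]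
  set s := q.roots with hs
  have hcard : Multiset.card s = n := by
    rw [hs, ← hqdeg]; exact splits_iff_card_roots.mp (IsAlgClosed.splits q)
  set l := s.toList with hl
  have hlen : l.length = n := by rw [hl, Multiset.length_toList, hcard]
  set f : Fin l.length → ℂ := fun i => l[i.val] with hf
  have hsf : (Finset.univ.val.map f) = s := by
    rw [Fin.univ_val_map, hf, List.ofFn_getElem, hl, Multiset.coe_toList]
  have hE : ∀ i, MvPolynomial.aeval f (MvPolynomial.esymm (Fin l.length) ℤ i) = s.esymm i := by
    intro i; rw [MvPolynomial.aeval_esymm_eq_multiset_esymm, hsf]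
  have hP : ∀ i, MvPolynomial.aeval f (MvPolynomial.psum (Fin l.length) ℤ i) = rootPowerSum p i := by
    intro i
    rw [rootPowerSum_def, MvPolynomial.psum, map_sum]
    simp_rw [map_pow, MvPolynomial.aeval_X]
    rw [Finset.sum_eq_multiset_sum, ← hq, ← hs, ← hsf, Multiset.map_map]
    rfl
  have hc : ∀ i, ((descCoeff p i : ℤ) : ℂ) = (-1) ^ i * s.esymm i := by
    intro i
    unfold descCoeff
    rw [← hn]
    split_ifs with hi
    · have hroots : Multiset.card q.roots = q.natDegree := by rw [← hs, hcard, hqdeg]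
      have hv := Polynomial.coeff_eq_esymm_roots_of_card hroots (k := n - i) (by rw [hqdeg]; omega)
      rw [hqmonic.leadingCoeff, one_mul, hqdeg, ← hs, show n - (n - i) = i by omega] at hv
      rw [← hv, hq, coeff_map]
      simp
    · push Not at hi
      rw [Multiset.esymm, Multiset.powersetCard_eq_empty _ (by rw [hcard]; exact hi)]
      simp
  have newton := congrArg (MvPolynomial.aeval f) (MvPolynomial.psum_eq_mul_esymm_sub_sum (Fin l.length) ℤ k hk)
  rw [map_sub, map_mul, map_mul, map_sum, hP, hE] at newton
  simp only [map_mul, map_pow, map_neg, map_one, map_natCast, hE, hP] at newton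
  rw [newton, Finset.sum_filter, Finset.Nat.sum_antidiagonal_eq_sum_range_succ_mk]
  obtain ⟨m, rfl⟩ : ∃ m, k = m + 1 := ⟨k - 1, by omega⟩
  rw [Finset.sum_range_succ, Finset.sum_range_succ', show m + 1 - 1 = m from rfl]
  have h0 : ¬ ((0 : ℕ) ∈ Set.Ioo 0 (m + 1)) := by simp
  have hlast : ¬ ((m + 1 : ℕ) ∈ Set.Ioo 0 (m + 1)) := by simp
  simp only [h0, hlast, if_false, add_zero]
  have hck := hc (m + 1)
  rw [show ∑ i ∈ Finset.range m, (if (i + 1) ∈ Set.Ioo 0 (m + 1) then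
      (-1) ^ (i + 1) * s.esymm (i + 1) * rootPowerSum p (m + 1 - (i + 1)) else 0) =
      ∑ j ∈ Finset.range m, (descCoeff p (j + 1) : ℂ) * rootPowerSum p (m - j) from ?_]
  · rw [hck]; push_cast; ring
  · apply Finset.sum_congr rfl
    intro j hj
    rw [Finset.mem_range] at hj
    have hmem : (j + 1) ∈ Set.Ioo 0 (m + 1) := by simp; omega
    rw [if_pos hmem, hc (j + 1), show m + 1 - (j + 1) = m - j by omega]

/-- **The list recursion computes the power sums.** For monic `p`, every `K` and `j < K`:
entry `j` of `psumsRev (descCoeffList p) K` is `P_{K-j}(p)`. -/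
theorem psumsRev_eq_rootPowerSum {p : ℤ[X]} (hp : p.Monic) (K : ℕ) :
    ∀ j < K, (((psumsRev (descCoeffList p) K).getD j 0 : ℤ) : ℂ) = rootPowerSum p (K - j) := by
  induction K with
  | zero => intro j hj; omega
  | succ K ih =>
    intro j hj
    cases j with
    | succ j =>
      rw [psumsRev_succ, List.getD_cons_succ, ih j (by omega), show K + 1 - (j + 1) = K - j by omega]
    | zero =>
      rw [psumsRev_succ, List.getD_cons_zero, newtonNext, length_psumsRev, sum_zipWith_mul_eq,
        length_psumsRev, Nat.sub_zero, rootPowerSum_newton hp (by omega), show K + 1 - 1 = K from rfl,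
        getD_descCoeffList]
      push_cast
      congr 1
      apply Finset.sum_congr rfl
      intro j hj
      rw [Finset.mem_range] at hj
      rw [getD_descCoeffList, ih j hj]

/-- Head form: `P_k(p) = (psumsRev (descCoeffList p) k).getD 0 0` for `k ≥ 1`. -/
theorem rootPowerSum_eq_head {p : ℤ[X]} (hp : p.Monic) {k : ℕ} (hk : 1 ≤ k) :
    rootPowerSum p k = (((psumsRev (descCoeffList p) k).getD 0 0 : ℤ) : ℂ) := by
  rw [psumsRev_eq_rootPowerSum hp k 0 (by omega), Nat.sub_zero]

end Summit.Ventures.DiscreteObjects.Mahler
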